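import Summits.ABC.IUTFork.Repair.EvalI06StarShape
import Literature.IUT.LogVolume.UnitLogValuationProfileNoZeta
import HarnessLib

/-!
# IUT RESCUE-H (D-0079 «local-height condition I06⋆»), seat abc-iut-rp-d4 — `EvalI06StarShapeNoZeta`: the SHAPE cells at print's
# own `K`-level pilot datum on the `(p−1) ∣ e_w` rows, under the first-order «no ζ_p» hypothesis (NZ)

PROOF-ONLY sequel (D-0012; 0 definitions, 0 `Prop` facts) of `Repair/EvalI06StarShape.lean` (p457897).  There the NEG-gap cell and the
SHAPE-OPEN witnesses carried `(p−1) ∤ e_w`, and the POS cell the strict `e_w < t·(p−1)`.  With the Literature layer now complete under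
**(NZ) `∀ X : K_w, ‖p‖ ≤ ‖X^{p−1} + p‖`** («−p is not a (p−1)-th power to first order» ⟸⟹ at (p−1) ∣ e_w «ζ_p ∉ K_w»; abc-iut-rp-d4
`UnitLogValuationProfileNoZeta` p458827), the NEG-gap cell holds on EVERY row of the `pilotDataOfK` family whose
completion satisfies (NZ) — a local-type hypothesis on the place, like `e_w`, never asserted:
* `chosenQIdele_not_mem_pow_smul_logShell_of_gap'` — NEG ⇐ `t` in a gap `h_s(a₀) < t < ν(s+1)` (non-strict turning data; ties allowed)
  — the NEG cells above the first tie level on the `(p−1) ∣ e_w` rows of the family.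
(The non-strict POS cell `e_w ≤ t·(p−1)` and the SHAPE-OPEN witnesses under (NZ) follow in the sequel `EvalI06StarShapeBoundary.lean`,
on top of `UnitLogValuationProfileBoundaryBall`.)
(`t = e_w − m·(n−1)`, `m = ord_w(q)/(2l)`, `c = 1` since `p ≠ 2` at bad places.)  TAKES NO SIDE on [IUTchIII] Cor. 3.12 or on any author;
candidates are hypotheses; typed ≠ proved; classical `p`-adic analysis about OUR typed objects.
[cite: NeukirchANT1999, Ch. II Prop. (5.5), (5.7)] [cite: Washington1997, Lemma 1.4, §5.1] [cite: MochizukiAbsTopIII2015, Def 5.4 (iii) p. 126]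
[cite: Mochizuki2012, IUTchI Def. 3.1 (b)(c) pp. 61–62, Ex. 3.2 (iv) p. 71] [claim: Mochizuki2012, status: disputed] for every IUT locution.
-/

noncomputable section

open Set Function NumberField IsDedekindDomain Metric
open scoped Pointwise

namespace Summit.ABC.IUTFork.Repair.EvalI06StarShape

open Literature.IUT.LogVolume Literature.IUT.HodgeTheaters Literature.IUT.LogVolume.ValuationProfile
  Literature.NumberTheory.GaloisRepresentations.Ultrametric Literature.AnabelianGeometry.AbsoluteAnabelian
  Thm311 Thm311.Real Cor312Prov

variable {F K Fbar : Type} [Field F] [NumberField F] [Field K] [NumberField K] [Algebra F K] [Field Fbar]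
  [Algebra F Fbar] [Algebra K Fbar] {E : WeierstrassCurve F} [E.IsElliptic] {l : ℕ} {Pb : BadPlacePredicates K}
  (D : InitialThetaData F K Fbar E l Pb)

/-- **DECIDED-NEG cell, gap form, under (NZ)** (ties allowed; `a₁` the NON-strict turning point of `s+1`):
`s·p^{a₀} − e·a₀ < t < (s+1)·p^{a₁} − e·a₁` ⟹ `q ∉ qⁿ·ℐ_w` (`ValuationProfile.not_mem_pow_smul_logShell_of_gap'`).
[cite: NeukirchANT1999, Ch. II Prop. (5.5)] -/
theorem chosenQIdele_not_mem_pow_smul_logShell_of_gap' (pp : Nat.Primes) (x₀ : (thetaIndex (pilotDataOfK D K)).Fibre (.inr pp))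
    (hx : haveI : Fact (pp : ℕ).Prime := ⟨pp.2⟩; placeOf (pilotDataOfK D K) pp.1 x₀ ∈ (pilotDataOfK D K).S)
    (hNZ : haveI : Fact (pp : ℕ).Prime := ⟨pp.2⟩
      ∀ X : kOf (pilotDataOfK D K) pp.1 x₀, ‖((pp : ℕ) : kOf (pilotDataOfK D K) pp.1 x₀)‖ ≤
        ‖X ^ ((pp : ℕ) - 1) + ((pp : ℕ) : kOf (pilotDataOfK D K) pp.1 x₀)‖)
    (n : ℕ) {s : ℤ} (hs : 1 ≤ s) {a₀ a₁ : ℕ}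
    (h1 : haveI : Fact (pp : ℕ).Prime := ⟨pp.2⟩
      s * ((pp : ℕ) : ℤ) ^ a₀ - (absRamificationIdx (pp : ℕ) (kOf (pilotDataOfK D K) pp.1 x₀) : ℤ) * (a₀ : ℤ) <
        (absRamificationIdx (pp : ℕ) (kOf (pilotDataOfK D K) pp.1 x₀) : ℤ) -
          (pilotDataOfK D K).ordq (placeOf (pilotDataOfK D K) pp.1 x₀) / (2 * (l : ℤ)) * ((n : ℤ) - 1))
    (hlo₁ : haveI : Fact (pp : ℕ).Prime := ⟨pp.2⟩
      ∀ a < a₁, (s + 1) * ((pp : ℕ) : ℤ) ^ a * (((pp : ℕ) : ℤ) - 1) < absRamificationIdx (pp : ℕ) (kOf (pilotDataOfK D K) pp.1 x₀))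
    (hhi₁ : haveI : Fact (pp : ℕ).Prime := ⟨pp.2⟩
      (absRamificationIdx (pp : ℕ) (kOf (pilotDataOfK D K) pp.1 x₀) : ℤ) ≤ (s + 1) * ((pp : ℕ) : ℤ) ^ a₁ * (((pp : ℕ) : ℤ) - 1))
    (h2 : haveI : Fact (pp : ℕ).Prime := ⟨pp.2⟩
      (absRamificationIdx (pp : ℕ) (kOf (pilotDataOfK D K) pp.1 x₀) : ℤ) -
          (pilotDataOfK D K).ordq (placeOf (pilotDataOfK D K) pp.1 x₀) / (2 * (l : ℤ)) * ((n : ℤ) - 1) <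
        (s + 1) * ((pp : ℕ) : ℤ) ^ a₁ - (absRamificationIdx (pp : ℕ) (kOf (pilotDataOfK D K) pp.1 x₀) : ℤ) * (a₁ : ℤ)) :
    haveI : Fact (pp : ℕ).Prime := ⟨pp.2⟩
    (exists_realising_qIdeles_pilotDataOfK D).choose pp x₀ ∉
      (exists_realising_qIdeles_pilotDataOfK D).choose pp x₀ ^ n •
        Literature.AnabelianGeometry.AbsoluteAnabelian.logShell (PadicLogOnUnits.ofUnitLog (pp : ℕ) (kOf (pilotDataOfK D K) pp.1 x₀)) := by
  haveI : Fact (pp : ℕ).Prime := ⟨pp.2⟩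
  obtain ⟨ϖ, hϖ⟩ := exists_isUniformizer (F := kOf (pilotDataOfK D K) pp.1 x₀)
  refine not_mem_pow_smul_logShell_of_gap' (pp : ℕ) hNZ hϖ ((exists_realising_qIdeles_pilotDataOfK D).choose_spec.1 pp x₀)
    (norm_chosenQIdele_eq_unif_zpow D pp x₀ hx hϖ) hs (a₀ := a₀) (a₁ := a₁) ?_ hlo₁ hhi₁ ?_
  · rw [pstar_exponent_eq_one D pp x₀ hx]; simpa using h1
  · rw [pstar_exponent_eq_one D pp x₀ hx]; simpa using h2

end Summit.ABC.IUTFork.Repair.EvalI06StarShape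

end
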